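import Summits.BirchSwinnertonDyer.Rank1Residual.X11b.LevelLiftingWithP
import HarnessLib

/-!
# Crux `AnticycControlAdditiveK` (route `SchneiderFreeAdditiveX3`, item stmt-BirchSwinnertonDyer-19295),
# stub `stub_ptSurj` (P9-𝓒): the Poitou–Tate lift WITHOUT the global no-`p`-torsion hypothesis
# (regime B2, `E(K)[p] ≠ 0`) — part 1: the level machinery

Seat `bsd-schneider-door-c6` (cell `bsd-schneider-ideate`), successor of `bsd-schneider-door-c4` on the
CONTROL corner of the K1 door. The X11b route-R1 engine (sub-cell multr1-p1, gen 15) proves JSW17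
Prop. 3.3.2 — the surjectivity of the localisation of the relaxed Selmer group of `E[p^∞]` onto the
local cohomology at finitely many places — modulo the cited Poitou–Tate fact
`poitouTate_selmerStructure_duality K`, under the GLOBAL hypothesis `E(K̄)[p^∞]^{Γ_K} = 0` (i.e.
`E(K)[p] = 0`), which it uses at exactly ONE point of the obstruction computation
`AcSelmer.sum_localTatePairingZMod_liftFamily_eq_zero`: to conclude `H¹(π) ỹ = 0` from
`H¹(ι_{K₀}) H¹(π) ỹ = p^e · H¹(ι_N) ỹ = 0` by the injectivity of
`H¹(ι_{K₀}) : H¹(K, E[p^{K₀}]) → H¹(K, E[p^∞])`. On the crux's regime B2 (`p = 3`, `E(K)[3] ≠ 0`,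
64.4 % of the `p = 3` isogeny classes of class X3) that injectivity FAILS. This file removes the
hypothesis by the torsion argument at the strict prime `𝔮 = 𝔭̄` of the dual structure, carried out
at finite level:

* `H¹(π) ỹ ∈ ker H¹(ι_{K₀})` is a CONNECTING CLASS `δ(b)`, `b ∈ E[p^∞]`, `p^{K₀} b = R ∈ E(K̄)[p^∞]^{Γ_K}`
  (the tree's `Levels.map_primaryInclusion_eq_zero_iff`, Kummer sequence
  `0 → E[p^{K₀}] → E[p^∞] → E[p^∞] → 0`);
* the dual class `y` is STRICT at `𝔮` (`𝓕_𝔮 = ⊤`, so `𝓕^*_𝔮 = 0` for a perfect local pairing), hence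
  `loc_𝔮 δ(b) = 0`, i.e. (naturality of `δ`, `res_connectingClass`, and exactness at
  `E(K̄_𝔮)`-points, `Levels.connectingClass_eq_zero_iff` over `K_𝔮`) `R = p^{K₀} b₀` for a
  `Γ_{K_𝔮}`-FIXED `b₀ ∈ E[p^∞]`;
* `E(K̄)[p^∞]^{Γ_{K_𝔮}} ≅ E(K_𝔮)[p^∞]` is FINITE, so once `p^{K₀}` kills it (the caller bumps `K₀`),
  `R = 0` and `δ(b) = 0`.

Results (same constructed objects, same remaining hypotheses as the R1 engine minus `hΓ`):
* `res_connectingClass` — naturality of the Kummer connecting classes under restriction to a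
  `K`-field (localisation);
* `sum_localTatePairingZMod_liftFamily_eq_zero_anyTorsion` — the obstruction vanishes, assuming instead
  that `p^{K₀}` kills `E(K̄)[p^∞]^{D_𝔮}`;
* `levelLiftingP_of_finite_anyTorsion_at` — (P9⁺): lifting prescribed local classes on `Σ ∪ {𝔭}`,
  killed by `p^{K₀}`, to a global class of `H¹_{𝓖⁺}(K, E[p^N])` (door-c4 gen 2's
  `levelLiftingP_of_finite_noLocal`, credit multr1-p1 / door-c4, with `hΓ` replaced by "`p^{K₀}` kills
  `E(K̄)[p^∞]^{D_𝔮}`").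

CONDITIONAL on the cited Poitou–Tate fact (a displayed hypothesis BY NAME); no `Prop` fact minted;
closes nothing by itself; BSD is not proved by any of this. Part 2
(`…AnticycControlAdditivePtSurjAnyTorsion.lean`) bumps the level (any killing exponent), derives (P9)
`LocSurjAt` and the element form (P9-𝓒) of the crux's torsion-robust glue at EVERY frame, and the
registered stub `stub_ptSurj` modulo the cited fact and the finiteness of Castella's Selmer groups.

References: [JetchevSkinnerWan2017] Prop. 3.3.2 (arXiv:1512.06894 p. 11: "it suffices to show that
`H¹_{(𝓕_ac^S)_v̄}(K, T) = 0` … torsion-free … finite"); [Howard2004HeegnerKolyvagin] Thm. 2.1.11;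
[GreenbergLNM1716] §2 p. 63, §5 proof of Prop. 5.8; [Castella2018] Def. 2.2, Thm. 2.3.
-/

noncomputable section

open scoped Classical

open CategoryTheory Field NumberField IsDedekindDomain
open Literature.NumberTheory.EllipticCurves Literature.NumberTheory.EllipticCurves.GreenbergSelmer
open Literature.NumberTheory.GaloisRepresentations
open Literature.NumberTheory.GaloisRepresentations.DiscreteGaloisModule (SelmerStructure TateDual
  tateDual localTatePairingZMod unramifiedSubgroup)
open Literature.NumberTheory.GaloisCohomology
open scoped ContRepresentation

set_option linter.dupNamespace false

namespace Summit.BirchSwinnertonDyer.BirchSwinnertonDyer.Theorems.SchneiderFreeAdditiveX3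

open Summit.BirchSwinnertonDyer.Rank1Residual.X11b
open Summit.BirchSwinnertonDyer.Rank1Residual.X11b.AcSelmer
open Summit.BirchSwinnertonDyer.Rank1Residual.X11b.LocBridge
open Summit.BirchSwinnertonDyer.Rank1Residual.X11b.Levels

/-! ## §1. Naturality of the Kummer connecting classes under restriction to a `K`-field -/

section Connecting

universe u

variable {F : Type u} [Field F] {A B : Type u} [AddCommGroup A] [TopologicalSpace A]
  [DiscreteTopology A] [AddCommGroup B] [TopologicalSpace B] [DiscreteTopology B]
  {ρA : DiscreteGaloisModule F A} {ρB : DiscreteGaloisModule F B}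

/-- **`res_E δ(b) = δ_E(b)`**: the connecting class of `b ∈ B` (with `n • b` invariant) for an injective
intertwining map `i : A ↪ B` restricts, to any `F`-field `E` (a completion `K_v`), to the connecting
class of the same `b` for the restricted modules over `E` (both are the class of `σ ↦ i⁻¹(σ b − b)`);
in particular `loc_v δ(b) = δ_v(b)` (`galoisCohomology.localization` is `res` at `K_v`).
Silverman, *AEC*, VIII.§2 (the Kummer sequence commutes with restriction). [folklore] -/
theorem res_connectingClass (E : Type u) [Field E] [Algebra F E]
    {i : ρA.toContRepresentation →ⁱL ρB.toContRepresentation} {n : ℕ}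
    {hrange : ∀ b : B, n • b = 0 → ∃ a : A, i a = b}
    {hrangeE : ∀ b : B, n • b = 0 → ∃ a : A, i.restrictField E a = b}
    (hinj : Function.Injective i) (hinjE : Function.Injective (i.restrictField E))
    (b : B) (hb : ∀ σ : absoluteGaloisGroup F, ρB σ (n • b) = n • b)
    (hbE : ∀ σ : absoluteGaloisGroup E, GaloisRep.restrictField E ρB σ (n • b) = n • b) :
    galoisCohomology.res ρA E 1 (connectingClass i n hrange hinj b hb) =
      connectingClass (ρB := GaloisRep.restrictField E ρB) (i.restrictField E) n hrangeE hinjE b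
        hbE := by
  unfold connectingClass
  rw [galoisCohomology.res_one_oneCocycleClass]
  refine congrArg (oneCocycleClass _) (Subtype.ext (ContinuousMap.ext fun σ ↦ hinjE ?_))
  have h2 : i ((liftCocycle i n hrange hinj (Levels.cobCocycle ρB b)
      (nsmul_cobCocycle_apply_eq_zero n hb)).1 (absGaloisRestrict F E σ)) =
      ρB (absGaloisRestrict F E σ) b - b := by
    rw [apply_liftCocycle hinj, Levels.cobCocycle_apply]
  rw [apply_liftCocycle hinjE, Levels.cobCocycle_apply]
  exact h2

end Connecting

/-! ## §2. The Poitou–Tate obstruction vanishes without `E(K)[p] = 0` -/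

section Obstruction

variable {K : Type} [Field K] [NumberField K] (W : WeierstrassCurve K) [W.IsElliptic] (p : ℕ)
  [Fact p.Prime] (𝔭 : HeightOneSpectrum (𝓞 K)) {S : Set (HeightOneSpectrum (𝓞 K))}
  (T : Finset (Place K)) (K₀ e : ℕ)

/-- **The Poitou–Tate obstruction of (P9) vanishes, WITHOUT `E(K̄)[p^∞]^{Γ_K} = 0`** (JSW17, proof of
Prop. 3.3.2, at the finite level `N = K₀ + e`): with `t = liftFamily W p K₀ e s` and
`𝓕 = lowerStructure W p N 𝔭 Σ T`, for every `y ∈ H¹_{𝓕^*}(K, E[p^N]^D)`,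
`∑_{v ∈ T} ⟨t_v, loc_v y⟩_v = 0`, provided `p^e` kills Castella's relaxed conjugate group
`H¹_{𝓛^{ac,R}_𝔮}(K, E[p^∞])` and `p^{K₀}` kills the FINITE group `E(K̄)[p^∞]^{Γ_{K_𝔮}}`. The class
`H¹(π) ỹ` dies under `H¹(ι_{K₀})` (as in the R1 engine), so it is a connecting class `δ(b)` with
`p^{K₀} b` invariant; `y` is strict at `𝔮`, so `loc_𝔮 δ(b) = 0`, so `p^{K₀} b = p^{K₀} b₀` with `b₀`
fixed by `Γ_{K_𝔮}`, so `p^{K₀} b = 0` and `δ(b) = 0`; the rest is the R1 computation verbatim (credit: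
sub-cell multr1-p1). [cite: JetchevSkinnerWan2017, Prop. 3.3.2 (arXiv:1512.06894 p. 11)]
[cite: MilneADT2006, Ch. I §6, proof of Prop. 6.9] -/
theorem sum_localTatePairingZMod_liftFamily_eq_zero_anyTorsion [CompactSpace (absoluteGaloisGroup K)]
    [NeZero (p ^ (K₀ + e))] [NeZero (p ^ K₀)] [Finite (W.geomTorsion ((p ^ (K₀ + e) : ℕ) : ℤ))]
    [Finite (W.geomTorsion ((p ^ K₀ : ℕ) : ℤ))]
    (hK : ∀ w : InfinitePlace K, w.IsComplex)
    {𝔮 : HeightOneSpectrum (𝓞 K)} (h𝔮 : ((p : ℕ) : 𝓞 K) ∈ 𝔮.asIdeal) (hne : 𝔮 ≠ 𝔭)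
    (htor : ∀ Q : W.geomPrimaryTorsion p, (∀ d ∈ decomp 𝔮, d • Q = Q) → p ^ K₀ • Q = 0)
    (hSig : ∀ v ∈ S, (Sum.inr v : Place K) ∈ T)
    (hbad : ∀ v : HeightOneSpectrum (𝓞 K), ¬ W.HasGoodReductionAt v → (Sum.inr v : Place K) ∈ T)
    (he1 : 1 ≤ e)
    (he : ∀ x ∈ (acStructure (primaryGaloisModule W p) p 𝔮
      {v | (Sum.inr v : Place K) ∈ T ∧ ((p : ℕ) : 𝓞 K) ∉ v.asIdeal}).selmerGroup, p ^ e • x = 0)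
    {inv : LocalInvariants K (p ^ (K₀ + e))} (hperf : inv.IsPerfect) (hur : inv.UnramifiedOrthogonal)
    (s : ∀ v : S, galoisCohomology (GaloisRep.restrictField
      (Place.Completion (Sum.inr (v : HeightOneSpectrum (𝓞 K)) : Place K))
      (W.torsionGaloisModule ((p ^ K₀ : ℕ) : ℤ))) 1)
    {y : galoisCohomology ((W.torsionGaloisModule ((p ^ (K₀ + e) : ℕ) : ℤ)).tateDual (p ^ (K₀ + e))) 1}
    (hy : y ∈ (inv.dualSelmerStructure (W.torsionGaloisModule ((p ^ (K₀ + e) : ℕ) : ℤ))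
        (lowerStructure W p (K₀ + e) 𝔭 S T)).selmerGroup) :
    ∑ v ∈ T, localTatePairingZMod (W.torsionGaloisModule ((p ^ (K₀ + e) : ℕ) : ℤ)) (p ^ (K₀ + e)) v
        (inv v) (liftFamily W p K₀ e s v)
        (galoisCohomology.localization
          ((W.torsionGaloisModule ((p ^ (K₀ + e) : ℕ) : ℤ)).tateDual (p ^ (K₀ + e))) v 1 y) = 0 := by
  have hprime : p.Prime := Fact.out
  have hdiv : W.zsmul_geomPoints_surjective := W.zsmul_geomPoints_surjective_holds
  -- a Weil pairing on `E[p^N]`, `N = K₀ + e ≥ 1`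
  have hp2 : 2 ≤ p ^ (K₀ + e) := le_trans hprime.two_le (Nat.le_self_pow (by omega) p)
  have hchar : ((p ^ (K₀ + e) : ℕ) : K) ≠ 0 := Nat.cast_ne_zero.mpr (pow_ne_zero _ hprime.ne_zero)
  obtain ⟨ε, hμ, hadd₁, hadd₂, -, hnondeg, hgal⟩ := W.exists_weilPairing_holds (p ^ (K₀ + e)) hp2 hchar
  set yW := galoisCohomology.map (weilDualInv W (p ^ (K₀ + e)) ε hμ hadd₁ hadd₂ hgal hnondeg) 1 y
    with hyWdef
  have hyW : galoisCohomology.map (weilDualIntertwining W (p ^ (K₀ + e)) ε hμ hadd₁ hadd₂ hgal) 1 yW = y :=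
    map_weilDual_map_weilDualInv W (p ^ (K₀ + e)) ε hμ hadd₁ hadd₂ hgal hnondeg y
  -- `H¹(ι_N) ỹ` lies in the relaxed conjugate group, hence is killed by `p^e`
  have hc := map_weilTransport_mem_selmerGroup_acStructure W p 𝔭 T ε hμ hadd₁ hadd₂ hgal hnondeg
    hK h𝔮 hne hSig hbad hperf hur hy
  have hkill : p ^ e • galoisCohomology.map (primaryInclusion W p (K₀ + e)) 1 yW = 0 := he _ hc
  -- `ỹ` is STRICT at `𝔮`: `𝓕_𝔮 = ⊤`, so `𝓕^*_𝔮 = 0`, so `loc_𝔮 y = 0`, so `loc_𝔮 ỹ = 0`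
  have hMn : ∀ m : W.geomTorsion ((p ^ (K₀ + e) : ℕ) : ℤ), (p ^ (K₀ + e)) • m = 0 := fun m ↦
    AddSubgroup.torsionBy.nsmul m
  have hyW𝔮 : galoisCohomology.localization (W.torsionGaloisModule ((p ^ (K₀ + e) : ℕ) : ℤ))
      (Sum.inr 𝔮) 1 yW = 0 := by
    have h𝓕 : lowerStructure W p (K₀ + e) 𝔭 S T (Sum.inr 𝔮) = ⊤ := by
      rw [lowerStructure_inr_of_not W p (K₀ + e) 𝔭 S T (fun h ↦ h.2 h𝔮)]
      exact acLevelStructure_eq_top_of_mem_of_ne W p (K₀ + e) 𝔭 S h𝔮 hne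
    have hy𝔮 := (SelmerStructure.mem_selmerGroup_iff _ y).1 hy (Sum.inr 𝔮)
    rw [LocalInvariants.dualSelmerStructure_apply, h𝓕,
      PoitouTateCounting.dualLocalCondition_top hperf (W.torsionGaloisModule ((p ^ (K₀ + e) : ℕ) : ℤ))
        hMn 𝔮, AddSubgroup.mem_bot, ← hyW, localization_map_one] at hy𝔮
    exact map_weilDual_restrictField_injective W (p ^ (K₀ + e)) ε hμ hadd₁ hadd₂ hgal hnondeg _
      (hy𝔮.trans (map_zero _).symm)
  -- level shift: `H¹(π) ỹ = 0` — by the torsion argument at `𝔮` instead of `E(K)[p] = 0`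
  have hπ : galoisCohomology.map (levelMul W p K₀ e) 1 yW = 0 := by
    set z := galoisCohomology.map (levelMul W p K₀ e) 1 yW with hzdef
    -- `H¹(ι_{K₀}) z = p^e · H¹(ι_N) ỹ = 0`, so `z = δ(b)` with `p^{K₀} b` invariant
    have hz0 : galoisCohomology.map (primaryInclusion W p K₀) 1 z = 0 := by
      rw [hzdef, map_primaryInclusion_map_levelMul, hkill]
    obtain ⟨b, hb, hzb⟩ := (map_primaryInclusion_eq_zero_iff W p K₀ z).mp hz0
    -- `loc_𝔮 z = 0` (as a restriction to the `K`-field `K_𝔮`)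
    have hz𝔮 : galoisCohomology.res (W.torsionGaloisModule ((p ^ K₀ : ℕ) : ℤ))
        (Place.Completion (Sum.inr 𝔮 : Place K)) 1 z = 0 := by
      change galoisCohomology.localization (W.torsionGaloisModule ((p ^ K₀ : ℕ) : ℤ))
        (Sum.inr 𝔮) 1 z = 0
      rw [hzdef, localization_map_one, hyW𝔮]
      exact map_zero _
    -- hence `loc_𝔮 δ(b) = δ_𝔮(b) = 0`: `p^{K₀} b = p^{K₀} b₀` with `b₀` fixed by `Γ_{K_𝔮}`
    have hbE : ∀ σ : absoluteGaloisGroup (Place.Completion (Sum.inr 𝔮 : Place K)),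
        GaloisRep.restrictField (Place.Completion (Sum.inr 𝔮 : Place K)) (primaryGaloisModule W p) σ
          (p ^ K₀ • b) = p ^ K₀ • b := fun σ ↦
      hb (absGaloisRestrict K (Place.Completion (Sum.inr 𝔮 : Place K)) σ)
    rw [hzb, res_connectingClass (Place.Completion (Sum.inr 𝔮 : Place K))
      (hrangeE := exists_primaryInclusion_restrictField_eq_of_nsmul_eq_zero W p K₀ _)
      (primaryInclusion_injective W p K₀) (primaryInclusion_restrictField_injective W p K₀ _) b hb hbE,
      connectingClass_eq_zero_iff (primaryInclusion_restrictField_injective W p K₀ _)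
        (pow_nsmul_geomTorsion_eq_zero W p K₀)] at hz𝔮
    obtain ⟨b₀, hb₀, hb₀b⟩ := hz𝔮
    -- `b₀` is fixed by the decomposition group `D_𝔮` (the image of `Γ_{K_𝔮}`)
    have hfix : ∀ d ∈ decomp 𝔮, d • b₀ = b₀ := fun d hd ↦ by
      obtain ⟨σ, hσ⟩ := (mem_decomp_iff 𝔮 d).mp hd
      have h1 : absGaloisRestrict K (𝔮.adicCompletion K) σ • b₀ = b₀ := hb₀ σ
      rwa [hσ] at h1
    -- `p^{K₀}` kills the `D_𝔮`-fixed `b₀`, so `p^{K₀} b = 0`, so `δ(b) = 0`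
    have hKb : p ^ K₀ • b = 0 := by rw [← hb₀b]; exact htor b₀ hfix
    rw [hzb, connectingClass_eq_zero_iff (primaryInclusion_injective W p K₀)
      (pow_nsmul_geomTorsion_eq_zero W p K₀)]
    exact ⟨0, fun σ ↦ map_zero _, by rw [smul_zero, hKb]⟩
  refine Finset.sum_eq_zero fun v _ ↦ ?_
  rcases v with w | v
  · rw [liftFamily_inl, map_zero, AddMonoidHom.zero_apply]
  · by_cases hvS : v ∈ S
    · have hπv : galoisCohomology.map ((levelMul W p K₀ e).restrictField
          (Place.Completion (Sum.inr v : Place K))) 1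
          (galoisCohomology.localization (W.torsionGaloisModule ((p ^ (K₀ + e) : ℕ) : ℤ))
            (Sum.inr v) 1 yW) = 0 := by
        rw [← localization_map_one, hπ]
        exact map_zero _
      rw [liftFamily_inr_of_mem W p K₀ e s hvS, ← hyW, localization_map_one,
        localTatePairingZMod_map_weilDual, weilContPairingLocal_cupProduct_eq_restrict,
        cupProduct_restrict_weil_map_levelIncl_eq_zero W p K₀ e hdiv ε hμ hadd₁ hadd₂ hgal
          (Place.Completion (Sum.inr v : Place K)) (s ⟨v, hvS⟩) hπv]
      exact map_zero _
    · rw [liftFamily_inr_of_not_mem W p K₀ e s hvS, map_zero, AddMonoidHom.zero_apply]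

end Obstruction

/-! ## §3. (P9⁺) without `E(K)[p] = 0`: lifting with prescribed localisations on `Σ ∪ {𝔭}` -/

section LiftP

variable {K : Type} [Field K] [NumberField K] (W : WeierstrassCurve K) [W.IsElliptic] (p : ℕ)
  [Fact p.Prime] (𝔭 : HeightOneSpectrum (𝓞 K)) (S : Set (HeightOneSpectrum (𝓞 K)))

/-- **(P9⁺) WITHOUT `E(K)[p] = 0` and WITHOUT (iv), at a killing level `K₀`**: hypotheses as in
door-c4's `levelLiftingP_of_finite_noLocal` (cited Poitou–Tate fact `poitouTate_selmerStructure_duality K`;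
all infinite places complex; `𝔭, 𝔮 ∣ p`, `𝔮 ≠ 𝔭`; `Σ` away from `p`; `T ⊇ ∞ ∪ {v∣p} ∪ Σ ∪ {bad}`;
`Finite (H¹_{𝓛^{ac,R}_𝔮}(K, E[p^∞]))`) EXCEPT that the global no-invariants hypothesis
`E(K̄)[p^∞]^{Γ_K} = 0` is replaced by: `p^{K₀}` kills the (finite) group `E(K̄)[p^∞]^{D_𝔮}` of points fixed
by the decomposition group at `𝔮`. For every family `τ_v ∈ H¹(K_v, E[p^∞])`, `v ∈ Σ⁺ = Σ ∪ {𝔭}`, killed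
by `p^{K₀}`, there are `N` and `x ∈ H¹_{𝓖⁺}(K, E[p^N])` with `loc_v (H¹(ι_N) x) = τ_v` for all `v ∈ Σ⁺`
(proof = door-c4's / multr1-p1's VERBATIM with the obstruction step
`sum_localTatePairingZMod_liftFamily_eq_zero_anyTorsion`). The user-facing form with an arbitrary
killing exponent (bump `K₀`) is in part 2.
[cite: JetchevSkinnerWan2017, Prop. 3.3.2 and Lemma 3.3.3 (arXiv:1512.06894 pp. 11–12)]
[cite: Howard2004HeegnerKolyvagin, Thm. 2.1.11 (arXiv:1202.6340 p. 6)] -/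
theorem levelLiftingP_of_finite_anyTorsion_at (T : Finset (Place K)) (hPT : poitouTate_selmerStructure_duality K)
    (hK : ∀ w : InfinitePlace K, w.IsComplex)
    {𝔮 : HeightOneSpectrum (𝓞 K)} (h𝔭 : ((p : ℕ) : 𝓞 K) ∈ 𝔭.asIdeal)
    (h𝔮 : ((p : ℕ) : 𝓞 K) ∈ 𝔮.asIdeal) (hne : 𝔮 ≠ 𝔭)
    (hSp : ∀ v ∈ S, ((p : ℕ) : 𝓞 K) ∉ v.asIdeal)
    (hinf : ∀ w : InfinitePlace K, (Sum.inl w : Place K) ∈ T)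
    (hp : ∀ v : HeightOneSpectrum (𝓞 K), ((p : ℕ) : 𝓞 K) ∈ v.asIdeal → (Sum.inr v : Place K) ∈ T)
    (hSig : ∀ v ∈ S, (Sum.inr v : Place K) ∈ T)
    (hbad : ∀ v : HeightOneSpectrum (𝓞 K), ¬ W.HasGoodReductionAt v → (Sum.inr v : Place K) ∈ T)
    (hfin : Finite ((acStructure (primaryGaloisModule W p) p 𝔮
      {v | (Sum.inr v : Place K) ∈ T ∧ ((p : ℕ) : 𝓞 K) ∉ v.asIdeal}).selmerGroup))
    (K₀ : ℕ) (htor : ∀ Q : W.geomPrimaryTorsion p, (∀ d ∈ decomp 𝔮, d • Q = Q) → p ^ K₀ • Q = 0)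
    (τ : ∀ v : (insert 𝔭 S : Set (HeightOneSpectrum (𝓞 K))),
      galoisCohomology
        ((primaryGaloisModule W p).toLocal (Sum.inr (v : HeightOneSpectrum (𝓞 K)))) 1)
    (hτ : ∀ v, p ^ K₀ • τ v = 0) :
    ∃ (N : ℕ) (x : galoisCohomology (W.torsionGaloisModule ((p ^ N : ℕ) : ℤ)) 1),
      x ∈ (upperStructureP W p N 𝔭 S).selmerGroup ∧
        ∀ v : (insert 𝔭 S : Set (HeightOneSpectrum (𝓞 K))),
          galoisCohomology.localization (primaryGaloisModule W p)
            (Sum.inr (v : HeightOneSpectrum (𝓞 K))) 1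
            (galoisCohomology.map (primaryInclusion W p N) 1 x) = τ v := by
  have hdiv : W.zsmul_geomPoints_surjective := W.zsmul_geomPoints_surjective_holds
  have hSig' : ∀ v ∈ insert 𝔭 S, (Sum.inr v : Place K) ∈ T := by
    intro v hv
    rcases Set.mem_insert_iff.1 hv with rfl | hv
    · exact hp v h𝔭
    · exact hSig v hv
  -- the exponent `e ≥ 1` of the relaxed conjugate group and the level `N = K₀ + e`
  haveI := hfin
  obtain ⟨e, he1, he⟩ := exists_pow_nsmul_eq_zero_of_finite
    ((acStructure (primaryGaloisModule W p) p 𝔮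
      {v | (Sum.inr v : Place K) ∈ T ∧ ((p : ℕ) : 𝓞 K) ∉ v.asIdeal}).selmerGroup)
  -- instances at level `p^N` (cup products need `CompactSpace Γ`; `E[p^N]` finite; `p^N ≠ 0`)
  haveI : CompactSpace (absoluteGaloisGroup K) := absoluteGaloisGroup_compactSpace K
  haveI : NeZero (p ^ (K₀ + e)) := ⟨pow_ne_zero _ (Fact.out : p.Prime).ne_zero⟩
  haveI : NeZero (p ^ K₀) := ⟨pow_ne_zero _ (Fact.out : p.Prime).ne_zero⟩
  haveI : Finite (W.geomTorsion ((p ^ (K₀ + e) : ℕ) : ℤ)) :=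
    W.finite_torsionPoints_holds (AlgebraicClosure K)
      (by exact_mod_cast pow_ne_zero (K₀ + e) (Fact.out : p.Prime).ne_zero)
  haveI : Finite (W.geomTorsion ((p ^ K₀ : ℕ) : ℤ)) :=
    W.finite_torsionPoints_holds (AlgebraicClosure K)
      (by exact_mod_cast pow_ne_zero K₀ (Fact.out : p.Prime).ne_zero)
  -- the Poitou–Tate family at level `p^N`
  obtain ⟨inv, hperf, -, hur, hcompl⟩ := hPT (p ^ (K₀ + e))
  -- local lifts `s_v ∈ H¹(K_v, E[p^{K₀}])` of the `τ_v`
  have hs : ∀ v : (insert 𝔭 S : Set (HeightOneSpectrum (𝓞 K))),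
      ∃ sv : galoisCohomology (GaloisRep.restrictField
      (Place.Completion (Sum.inr (v : HeightOneSpectrum (𝓞 K)) : Place K))
      (W.torsionGaloisModule ((p ^ K₀ : ℕ) : ℤ))) 1,
      galoisCohomology.map ((primaryInclusion W p K₀).restrictField
        (Place.Completion (Sum.inr (v : HeightOneSpectrum (𝓞 K)) : Place K))) 1 sv = τ v := fun v ↦
    (mem_range_map_primaryInclusion_restrictField_iff W p K₀ _ hdiv (τ v)).mpr (hτ v)
  choose s hs using hs
  -- the Poitou–Tate data
  have hMn : ∀ m : W.geomTorsion ((p ^ (K₀ + e) : ℕ) : ℤ), (p ^ (K₀ + e)) • m = 0 := fun m ↦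
    AddSubgroup.torsionBy.nsmul m
  have hTout : ∀ v : HeightOneSpectrum (𝓞 K), (Sum.inr v : Place K) ∉ T →
      ((p ^ (K₀ + e) : ℕ) : 𝓞 K) ∉ v.asIdeal ∧
        GaloisRep.IsUnramifiedAt v (W.torsionGaloisModule ((p ^ (K₀ + e) : ℕ) : ℤ)) := by
    intro v hv
    have hpv : ((p : ℕ) : 𝓞 K) ∉ v.asIdeal := fun h ↦ hv (hp v h)
    have hgood : W.HasGoodReductionAt v := by
      by_contra hbad'
      exact hv (hbad v hbad')
    exact ⟨natCast_pow_not_mem p hpv _,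
      isUnramifiedAt_torsionGaloisModule W hgood (intCast_pow_not_mem p hpv _)⟩
  have ht : ∀ v ∈ T, liftFamily W p K₀ e s v ∈ upperStructureP W p (K₀ + e) 𝔭 S v := by
    intro v _
    rcases v with w | v
    · rw [liftFamily_inl]; exact zero_mem _
    · by_cases hvI : v ∈ insert 𝔭 S
      · by_cases hv𝔭 : v = 𝔭
        · subst hv𝔭
          rw [upperStructureP_self]; exact AddSubgroup.mem_top _
        · have hvS : v ∈ S := by
            rcases Set.mem_insert_iff.1 hvI with h | h
            · exact (hv𝔭 h).elim
            · exact h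
          rw [upperStructureP_of_ne W p (K₀ + e) 𝔭 S (fun h ↦ hv𝔭 (Sum.inr_injective h)),
            acLevelStructure_eq_top_of_mem_S W p (K₀ + e) 𝔭 S hvS hv𝔭]
          exact AddSubgroup.mem_top _
      · rw [liftFamily_inr_of_not_mem W p K₀ e s hvI]; exact zero_mem _
  -- Poitou–Tate: the lift exists
  obtain ⟨x, hx, hxt⟩ := (hcompl (W.torsionGaloisModule ((p ^ (K₀ + e) : ℕ) : ℤ)) hMn T hTout
    (lowerStructure W p (K₀ + e) 𝔭 (insert 𝔭 S) T) (upperStructureP W p (K₀ + e) 𝔭 S)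
    (lowerStructure_insert_le_upperStructureP W p (K₀ + e) 𝔭 S T)
    (lowerStructure_isUnramifiedOutside W p (K₀ + e) 𝔭 (insert 𝔭 S) T hinf hp hSig' hbad)
    (upperStructureP_isUnramifiedOutside W p (K₀ + e) 𝔭 S T h𝔭 hinf hp hSig hbad)).1
    (liftFamily W p K₀ e s) ht fun y hy ↦
      sum_localTatePairingZMod_liftFamily_eq_zero_anyTorsion W p 𝔭 T K₀ e hK h𝔮 hne htor hSig' hbad
        he1 he hperf hur s hy
  refine ⟨K₀ + e, x, hx, fun v ↦ ?_⟩
  have hv := hxt (Sum.inr (v : HeightOneSpectrum (𝓞 K))) (hSig' v v.2)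
  by_cases hv𝔭 : (v : HeightOneSpectrum (𝓞 K)) = 𝔭
  · -- at `𝔭` the lower structure is Castella's PROPAGATED strict condition, the kernel of
    -- `H¹(K_𝔭, E[p^N]) → H¹(K_𝔭, E[p^∞])`: the lift hits `τ_𝔭` after `H¹(ι_N)` (no (iv) needed)
    rw [lowerStructure_inr_of_not W p (K₀ + e) 𝔭 (insert 𝔭 S) T
        (fun h ↦ h.2 (by rw [hv𝔭]; exact h𝔭)), hv𝔭, acLevelStructure_insert_self,
      acLevelStructure_eq_ker_of W p (K₀ + e) 𝔭 S (acStructure_self (primaryGaloisModule W p) p 𝔭 S)]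
      at hv
    have hv2 := (AddMonoidHom.mem_ker).1 hv
    rw [map_sub, sub_eq_zero] at hv2
    have hv' : galoisCohomology.map ((primaryInclusion W p (K₀ + e)).restrictField
        (Place.Completion (Sum.inr (v : HeightOneSpectrum (𝓞 K)) : Place K))) 1
        (galoisCohomology.localization (W.torsionGaloisModule ((p ^ (K₀ + e) : ℕ) : ℤ))
          (Sum.inr (v : HeightOneSpectrum (𝓞 K))) 1 x) =
        galoisCohomology.map ((primaryInclusion W p (K₀ + e)).restrictField
        (Place.Completion (Sum.inr (v : HeightOneSpectrum (𝓞 K)) : Place K))) 1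
        (liftFamily W p K₀ e s (Sum.inr (v : HeightOneSpectrum (𝓞 K)))) := by
      rw [hv𝔭]
      exact hv2
    rw [localization_map_one, hv', liftFamily_inr_of_mem W p K₀ e s v.2,
      map_primaryInclusion_map_levelIncl_restrictField]
    exact hs v
  · have hvS : (v : HeightOneSpectrum (𝓞 K)) ∈ S := by
      rcases Set.mem_insert_iff.1 v.2 with h | h
      · exact (hv𝔭 h).elim
      · exact h
    have h0 : lowerStructure W p (K₀ + e) 𝔭 (insert 𝔭 S) T
        (Sum.inr (v : HeightOneSpectrum (𝓞 K))) = ⊥ :=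
      lowerStructure_inr_of_mem W p (K₀ + e) 𝔭 (insert 𝔭 S) T (hSig' v v.2) (hSp _ hvS)
    rw [h0, AddSubgroup.mem_bot, sub_eq_zero, liftFamily_inr_of_mem W p K₀ e s v.2] at hv
    rw [localization_map_one, hv, map_primaryInclusion_map_levelIncl_restrictField]
    exact hs v

end LiftP

end Summit.BirchSwinnertonDyer.BirchSwinnertonDyer.Theorems.SchneiderFreeAdditiveX3

end
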